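import Summits.QuantumFields.YangMills.Theorems.LuscherReductionTwistedTraceScalingBOStiffCoreCoeffInt
import Summits.QuantumFields.YangMills.Theorems.FlatTubeReductionStiffKFibreTail
import Summits.QuantumFields.YangMills.Theorems.FlatTubeReductionStiffKWeightTransport
import HarnessLib


/-!
# (B-ST) K-port, part 3: THE FIBREWISE GROUND COEFFICIENT OF THE CORE PIECE OF RECORD, at a GENERAL CAP CONSTANT `K ≥ 1`
# (route `FlatTubeReduction`, crux K1 `NearFlatRatioLaw` stmt-QuantumFields-24720, line `ratepack_v2`, stub `stub_hST_A`; seat `ym-line-ftr-p1` g20; R2b1 RECORD rung — no summit statement is proved here)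

Lane A's ✓`…BOStiffCoreCoeff.core_coeff_sq_le_mul_recordGamma`, ✓`…BOStiffCoreCoeffMass.core_coeff_sq_le_mul_fibreMass_one`, ✓`…BOStiffCoreCoeffInt.core_coeff_integral_le` VERBATIM with the
cap constant `43` of `recordChi L s 43 M β` replaced by a parameter `K ≥ 1` (the rate twin's stub `stub_hST_A` needs `K = 42·max 1 (|Site 3 L|/7) + 1` at `s = 1/6`):
* ★★★ `core_coeff_sq_le_mul_recordGamma_K` — `(∫_x v₁(oT u x)·Ω_c(x̂)·softWeight χ_K (oT 1 x) dπ)² ≤ a·γ(β)·∫_x v(oT u x)²·softWeight χ_K (oT u x) dπ`, every `a > 0`, every `u`, eventually;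
* ★★★ `core_coeff_sq_le_mul_fibreMass_one_K` — the same against `Z̄ = fibreMass L (softWeight χ_K) Ω_c 1`;
* ★★★ `core_coeff_integral_le_K` — integrated over `u`: `C ≤ a·‖v‖²_w`.
HONEST FRAMING: text port (slot substitution `43 ↦ K`) of lane A's bookkeeping for a stub of the crux K1 of the CONDITIONAL route R2b1 (RECORD rung); no new mathematics; not infinite volume,
not a gap, not Clay.
-/

set_option autoImplicit false

noncomputable section

open MeasureTheory Filter Topology Real
open scoped BigOperators
open Literature.MathematicalPhysics.QuantumFieldTheory
open Literature.MathematicalPhysics.QuantumLattice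

namespace Summit.QuantumFields.YangMills.Theorems.FemtoTransferGap.TwoLattice.ConstTube

open Summit.QuantumFields.YangMills.Theorems.FemtoTransferGap
open Summit.QuantumFields.YangMills.Theorems.FemtoTransferGap.TwoLattice
open Summit.QuantumFields.YangMills.Theorems.FemtoTransferGap.TwoLattice.Avg
open Summit.QuantumFields.YangMills.Theorems.FemtoTransferGap.TwoLattice.Stiff
open Summit.QuantumFields.YangMills.Theorems.FemtoTransferGap.TwoLattice.GnChart
open Summit.QuantumFields.YangMills.Theorems.FemtoTransferGap.TwoLattice.Cov
open Summit.QuantumFields.YangMills.Theorems.FemtoTransferGap.TwoLattice.Toron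

variable {L : ℕ} [NeZero L]

/-! ## §1 The fibrewise ground coefficient against `γ` -/

set_option maxHeartbeats 1600000 in
-- long record expressions.
/-- ★★★ **THE FIBREWISE GROUND COEFFICIENT OF THE CORE PIECE OF RECORD** (see the module docstring): `∃ M₀ ≥ 2, ∀ M ≥ M₀, ∀ a > 0, ∀ᶠ β, ∀ u, ∀ v` admissible with
`fibreInner L (softWeight χ) Ω_c v u = 0`:  `(∫_x v₁(oT u x)·Ω_c(x̂)·softWeight χ (oT 1 x) dπ)² ≤ a·γ(β)·∫_x v(oT u x)²·softWeight χ (oT u x) dπ`,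
`v₁ = 𝟙_{(S₂(β)∪S₃(β))ᶜ}·v`. [cite: Luscher1983, §3] -/
theorem core_coeff_sq_le_mul_recordGamma_K {K : ℝ} (hK : 1 ≤ K) (hLz : Nonempty (NzSite L)) (hL : 2 ≤ L) {s : ℝ} (hs : 0 < s) (hs3 : s ≤ 1 / 3) :
    ∃ M₀ : ℝ, 2 ≤ M₀ ∧ ∀ M : ℝ, M₀ ≤ M → ∀ a : ℝ, 0 < a → ∀ᶠ β : ℝ in atTop, ∀ u : GaugeConfig 3 1 SU2,
      ∀ v : GaugeConfig 3 L SU2 → ℝ, Measurable v → (∃ C : ℝ, ∀ U, |v U| ≤ C) → (∀ U, v U ≠ 0 → recordChi L s K M β U ≠ 0) →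
        fibreInner L (softWeight (recordChi L s K M β)) (fun x : LinkSpace L => {x : LinkSpace L | linkCurry x ∈ capBalancedSet L}.indicator (fun _ => (1 : ℝ)) x *
          frozenProfile L (fun β' => stiffGaussExp L (β' / 2) β') (fun β' => min (1 / 40) (powScale (1 / 2) β' * btLog β')) β x) v u = 0 →
        (∫ x, ({U : GaugeConfig 3 L SU2 | powScale 1 β * btLog β < ‖(gaugeModes L).starProjection (relLinkVec L U)‖} ∪
                  {U : GaugeConfig 3 L SU2 | min (1 / 40) (powScale (1 / 2) β * btLog β) / 2 < ‖relLinkVec L U‖})ᶜ.indicator v (orthoTube L u x) *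
              ({x : LinkSpace L | linkCurry x ∈ capBalancedSet L}.indicator (fun _ => (1 : ℝ)) (linkEmbed L x) *
                frozenProfile L (fun β' => stiffGaussExp L (β' / 2) β') (fun β' => min (1 / 40) (powScale (1 / 2) β' * btLog β')) β (linkEmbed L x)) *
              softWeight (recordChi L s K M β) (orthoTube L 1 x) ∂orthoTransverse L) ^ 2 ≤
          a * recordGamma L (fun β' => fun x : LinkSpace L => {x : LinkSpace L | linkCurry x ∈ capBalancedSet L}.indicator (fun _ => (1 : ℝ)) x *
              frozenProfile L (fun β'' => stiffGaussExp L (β'' / 2) β'') (fun β'' => min (1 / 40) (powScale (1 / 2) β'' * btLog β'')) β' x) β *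
            ∫ x, v (orthoTube L u x) ^ 2 * softWeight (recordChi L s K M β) (orthoTube L u x) ∂orthoTransverse L := by
  haveI := isFiniteMeasure_orthoTransverse L
  -- (P) for the record weight
  have hK0 : 0 < K := lt_of_lt_of_le one_pos hK
  have hδ0 : ∀ β, 0 < K * powScale s β := fun β => mul_pos hK0 (powScale_pos s β)
  have hδ : Tendsto (fun β => K * powScale s β) atTop (𝓝 0) := by simpa using (tendsto_powScale hs).const_mul K
  have hsd1 : ∀ᶠ β in atTop, 0 < powScale 1 β ∧ powScale 1 β ≤ (K * powScale s β) ^ 3 := by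
    filter_upwards [eventually_ge_atTop (1 : ℝ)] with β hβ
    have hp := powScale_pos 1 β
    have h1 : powScale 1 β ≤ powScale s β ^ 3 := powScale_one_le_cube hs3 hβ
    have hps0 : 0 ≤ powScale s β ^ 3 := pow_nonneg (powScale_pos s β).le 3
    refine ⟨hp, h1.trans ?_⟩
    calc powScale s β ^ 3 = 1 * powScale s β ^ 3 := (one_mul _).symm
      _ ≤ K ^ 3 * powScale s β ^ 3 := mul_le_mul_of_nonneg_right (one_le_pow₀ hK) hps0
      _ = (K * powScale s β) ^ 3 := by ring
  obtain ⟨M₁, hM₁, H₁⟩ := fpWeight_core_constant L hLz hδ0 hδ hsd1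
  obtain ⟨M₂, hM₂, H₂⟩ := eventually_fibre_tail_le_mul_recordGamma_K (L := L) hK hLz hL hs hs3
  refine ⟨max M₁ M₂, le_max_of_le_left hM₁, fun M hM a ha => ?_⟩
  have hM2 : 2 ≤ M := hM₁.trans ((le_max_left _ _).trans hM)
  obtain ⟨C, β₀, hC, hP⟩ := H₁ M ((le_max_left _ _).trans hM)
  have hδ2 : Tendsto (fun β => (K * powScale s β) ^ 2) atTop (𝓝 0) := by simpa using hδ.pow 2
  -- smallness of the comparison constant: `η = 2Cδ²/(1−Cδ²) ≤ 4Cδ²`, `2·η²·2 ≤ a/2` eventually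
  have hη : ∀ᶠ β : ℝ in atTop, 2 * ((4 * (C * (K * powScale s β) ^ 2)) ^ 2 * 2) ≤ a / 2 := by
    have h := ((hδ2.const_mul C).const_mul 4).pow 2 |>.mul_const 2 |>.const_mul 2
    rw [mul_zero, mul_zero, zero_pow two_ne_zero, zero_mul, mul_zero] at h
    exact h.eventually (eventually_le_nhds (by positivity))
  filter_upwards [eventually_ge_atTop β₀, eventually_mul_le_of_tendsto hδ2 C (by norm_num : (0 : ℝ) < 1 / 2), hη,
    H₂ M ((le_max_right _ _).trans hM) (a / 4) (by positivity), eventually_orthoTube_one_mem_fatTube_K (L := L) hK hs (by linarith) hM2]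
    with β hβ0 hCδ hηβ htail hgeo u v hv hCb hsupp horth
  obtain ⟨Cv, hCv⟩ := hCb
  -- names
  set χ := recordChi L s K M β with hχdef
  set F := fatTubeRho L (fun β => K * powScale s β) (fun b => M * (K * powScale s b)) β with hFdef
  set Ω : LinkSpace L → ℝ := fun x => {x : LinkSpace L | linkCurry x ∈ capBalancedSet L}.indicator (fun _ => (1 : ℝ)) x *
    frozenProfile L (fun β' => stiffGaussExp L (β' / 2) β') (fun β' => min (1 / 40) (powScale (1 / 2) β' * btLog β')) β x with hΩdef
  set Θ : (Edge 3 L → Fin 3 → ℝ) → ℝ := fun x => Ω (linkEmbed L x) with hΘdef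
  set g : (Edge 3 L → Fin 3 → ℝ) → ℝ := fun x => v (orthoTube L u x) with hgdef
  set w : (Edge 3 L → Fin 3 → ℝ) → ℝ := fun x => softWeight χ (orthoTube L u x) with hwdef
  set wb : (Edge 3 L → Fin 3 → ℝ) → ℝ := fun x => softWeight χ (orthoTube L 1 x) with hwbdef
  set rf : ℝ := min (1 / 40) (powScale (1 / 2) β * btLog β) with hrfdef
  set τ : ℝ := powScale 1 β * btLog β with hτdef
  set S₂ : Set (GaugeConfig 3 L SU2) := {U | τ < ‖(gaugeModes L).starProjection (relLinkVec L U)‖} with hS₂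
  set S₃ : Set (GaugeConfig 3 L SU2) := {U | rf / 2 < ‖relLinkVec L U‖} with hS₃
  set Sx : Set (Edge 3 L → Fin 3 → ℝ) := {x | ‖linkEmbed L x‖ ≤ rf / 2 ∧ ‖(gaugeModes L).starProjection (linkEmbed L x)‖ ≤ τ} with hSx
  set S' : Set (Edge 3 L → Fin 3 → ℝ) := Sx ∩ {x | Θ x ≠ 0} with hS'
  set κ : ℝ := C * (K * powScale s β) ^ 2 with hκdef
  set Nbar := fpWeightBar L (powScale 1 β) with hNbar
  have hNbar0 : 0 < Nbar := fpWeightBar_pos L (powScale_pos 1 β)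
  have hκ0 : 0 ≤ κ := by positivity
  have hκ1 : κ ≤ 1 / 2 := hCδ
  -- data: measurability and bounds
  have hqfm : ∀ β', Measurable ((fun β'' : ℝ => stiffGaussExp L (β'' / 2) β'') β') := fun β' => measurable_stiffGaussExp _ _
  have hqf0 : ∀ β' x, 0 ≤ (fun β'' : ℝ => stiffGaussExp L (β'' / 2) β'') β' x := fun β' x => stiffGaussExp_nonneg _ _ x
  have hΩGm : Measurable (frozenProfile L (fun β' => stiffGaussExp L (β' / 2) β') (fun β' => min (1 / 40) (powScale (1 / 2) β' * btLog β')) β) :=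
    measurable_frozenProfile hqfm _ β
  have hΩG0 : ∀ x, 0 ≤ frozenProfile L (fun β' => stiffGaussExp L (β' / 2) β') (fun β' => min (1 / 40) (powScale (1 / 2) β' * btLog β')) β x :=
    fun x => (frozenProfile_mem_Icc hqf0 _ β x).1
  have hΩG1 : ∀ x, |frozenProfile L (fun β' => stiffGaussExp L (β' / 2) β') (fun β' => min (1 / 40) (powScale (1 / 2) β' * btLog β')) β x| ≤ 1 :=
    abs_frozenProfile_le hqf0 _ β
  have hΩm : Measurable Ω := measurable_capRestrict (L := L) hΩGm
  have hΩ1 : ∀ x, |Ω x| ≤ 1 := fun x => (capRestrict_mem (L := L) hΩG0 hΩG1 x).2.2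
  have hΘm : Measurable Θ := hΩm.comp (measurable_linkEmbed L)
  have hΘb : ∀ x, |Θ x| ≤ 1 := fun x => hΩ1 _
  obtain ⟨hsm, hsb, hs0, -⟩ := softWeight_recordChi_props (L := L) s K M β
  have hgm : Measurable g := hv.comp (measurable_orthoTube_right u)
  have hgb : ∀ x, |g x| ≤ Cv := fun x => hCv _
  have hwm : Measurable w := hsm.comp (measurable_orthoTube_right u)
  have hwbm : Measurable wb := hsm.comp (measurable_orthoTube_right 1)
  have hw0 : ∀ x, 0 ≤ w x := fun x => hs0 _
  have hl : Continuous fun x : Edge 3 L → Fin 3 → ℝ => linkEmbed L x := (linkEmbed L).continuous_of_finiteDimensional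
  have hSxm : MeasurableSet Sx :=
    (measurableSet_le hl.norm.measurable measurable_const).inter (measurableSet_le ((gaugeModes L).starProjection.continuous.comp hl).norm.measurable measurable_const)
  have hS'm : MeasurableSet S' := hSxm.inter (hΘm (measurableSet_singleton (0 : ℝ)).compl)
  -- the orthogonality hypothesis in fibre coordinates
  have horth' : ∫ x, g x * Θ x * w x ∂orthoTransverse L = 0 := by simpa [fibreInner, hgdef, hΘdef, hwdef, hΩdef] using horth
  -- the weight comparison on `S' ∩ {g ≠ 0}`
  have hP' : ∀ U ∈ F, Nbar * (1 - κ) ≤ gaugeAvg χ U ∧ gaugeAvg χ U ≤ Nbar * (1 + κ) := fun U hU => hP β hβ0 U hU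
  have hcmp : ∀ x ∈ S', g x ≠ 0 → |wb x - w x| ≤ 2 * κ / (1 - κ) * w x := by
    intro x hx hgx
    have hΘx : Θ x ≠ 0 := hx.2
    have hxcap : x ∈ capBalancedSet L := (linkEmbed_mem_capLink_iff x).1 (by
      by_contra h; exact hΘx (by simp only [hΘdef, hΩdef, Set.indicator_of_notMem h, zero_mul]))
    have hU : orthoTube L u x ∈ F := by
      have h := hsupp _ hgx
      by_contra hU; exact h (by rw [hχdef, recordChi_eq_indicator_mul, Set.indicator_of_notMem hU, zero_mul])
    have hU₁ : orthoTube L 1 x ∈ F := hgeo x hΘx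
    exact softWeight_orthoTube_compare s K M β hκ0 (by linarith) hP' u hxcap hU hU₁
  -- apply the abstract almost-orthogonality inequality
  have key := StiffDoor.sq_integral_core_profile_le' (μ := orthoTransverse L) hgm hgb hΘm hΘb hwm (fun x => hsb _) hw0 hwbm (fun x => hsb _) hS'm hcmp horth'
  -- identify the left side: `v₁(oT u x)·Θ(x) = 𝟙_{S'} g (x)·Θ(x)`
  have hlhs : ∀ x, (S₂ ∪ S₃)ᶜ.indicator v (orthoTube L u x) * Θ x * wb x = S'.indicator g x * Θ x * wb x := fun x => by
    by_cases hΘx : Θ x = 0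
    · simp only [hΘx, mul_zero, zero_mul]
    · have hxcap : x ∈ capBalancedSet L := (linkEmbed_mem_capLink_iff x).1 (by
        by_contra h; exact hΘx (by simp only [hΘdef, hΩdef, Set.indicator_of_notMem h, zero_mul]))
      have hrel : relLinkVec L (orthoTube L u x) = linkEmbed L x := relLinkVec_orthoTube L u hxcap
      by_cases hxS : x ∈ Sx
      · have h1 : orthoTube L u x ∈ (S₂ ∪ S₃)ᶜ := by
          rw [Set.mem_compl_iff, Set.mem_union, not_or]
          simp only [hS₂, hS₃, Set.mem_setOf_eq, hrel, not_lt]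
          exact ⟨hxS.2, hxS.1⟩
        rw [Set.indicator_of_mem h1, Set.indicator_of_mem (show x ∈ S' from ⟨hxS, hΘx⟩)]
      · have h1 : orthoTube L u x ∉ (S₂ ∪ S₃)ᶜ := by
          rw [Set.mem_compl_iff, not_not, Set.mem_union]
          simp only [hS₂, hS₃, Set.mem_setOf_eq, hrel]
          simp only [hSx, Set.mem_setOf_eq, not_and_or, not_le] at hxS
          rcases hxS with h | h
          · exact Or.inr h
          · exact Or.inl h
        rw [Set.indicator_of_notMem h1, Set.indicator_of_notMem (show x ∉ S' from fun h => hxS h.1)]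
  have hlhs' : ∫ x, (S₂ ∪ S₃)ᶜ.indicator v (orthoTube L u x) * Θ x * wb x ∂orthoTransverse L = ∫ x, S'.indicator g x * Θ x * wb x ∂orthoTransverse L :=
    integral_congr_ae (ae_of_all _ hlhs)
  -- identify the tail: `(𝟙_{S'ᶜ}Θ)² = (𝟙_{Sxᶜ}Θ)²`
  have htail_eq : ∀ x, S'ᶜ.indicator Θ x ^ 2 * w x = (Sxᶜ.indicator Θ x) ^ 2 * w x := fun x => by
    by_cases hΘx : Θ x = 0
    · simp only [Set.indicator, hΘx]; split_ifs <;> simp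
    · by_cases hxS : x ∈ Sx
      · rw [Set.indicator_of_notMem (show x ∉ S'ᶜ from fun h => h ⟨hxS, hΘx⟩), Set.indicator_of_notMem (show x ∉ Sxᶜ from fun h => h hxS)]
      · rw [Set.indicator_of_mem (show x ∈ S'ᶜ from fun h => hxS h.1), Set.indicator_of_mem (show x ∈ Sxᶜ from hxS)]
  have htail_eq' : ∫ x, S'ᶜ.indicator Θ x ^ 2 * w x ∂orthoTransverse L = ∫ x, (Sxᶜ.indicator Θ x) ^ 2 * w x ∂orthoTransverse L :=
    integral_congr_ae (ae_of_all _ htail_eq)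
  -- the two masses: `Z_u ≤ (1+κ)γ`, `tail_u ≤ (a/4)γ`
  have hZ : ∫ x, Θ x ^ 2 * w x ∂orthoTransverse L ≤ (1 + κ) * recordGamma L (fun β' => fun x : LinkSpace L => {x : LinkSpace L | linkCurry x ∈ capBalancedSet L}.indicator (fun _ => (1 : ℝ)) x *
      frozenProfile L (fun β'' => stiffGaussExp L (β'' / 2) β'') (fun β'' => min (1 / 40) (powScale (1 / 2) β'' * btLog β'')) β' x) β :=
    fibre_sq_mass_le_K s K M β hκ0 (fun U hU => (hP' U hU).2) u
  have hT := htail u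
  set γ := recordGamma L (fun β' => fun x : LinkSpace L => {x : LinkSpace L | linkCurry x ∈ capBalancedSet L}.indicator (fun _ => (1 : ℝ)) x *
      frozenProfile L (fun β'' => stiffGaussExp L (β'' / 2) β'') (fun β'' => min (1 / 40) (powScale (1 / 2) β'' * btLog β'')) β' x) β with hγdef
  have hγ0 : 0 ≤ γ := by
    rw [hγdef]; unfold recordGamma boGamma
    exact mul_nonneg (fpWeightBar_pos L (powScale_pos 1 β)).le (integral_nonneg fun v => mul_nonneg (sq_nonneg _) (Real.exp_pos _).le)
  set N := ∫ x, g x ^ 2 * w x ∂orthoTransverse L with hNdef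
  have hN0 : 0 ≤ N := integral_nonneg fun x => mul_nonneg (sq_nonneg _) (hw0 x)
  -- the comparison constant
  have hη1 : 2 * κ / (1 - κ) ≤ 4 * κ := by
    rw [div_le_iff₀ (by linarith)]; nlinarith
  have hη2 : (2 * κ / (1 - κ)) ^ 2 ≤ (4 * κ) ^ 2 := pow_le_pow_left₀ (div_nonneg (by positivity) (by linarith)) hη1 2
  rw [hlhs']
  rw [htail_eq'] at key
  calc (∫ x, S'.indicator g x * Θ x * wb x ∂orthoTransverse L) ^ 2
      ≤ 2 * ((2 * κ / (1 - κ)) ^ 2 * (∫ x, Θ x ^ 2 * w x ∂orthoTransverse L) + ∫ x, (Sxᶜ.indicator Θ x) ^ 2 * w x ∂orthoTransverse L) * N := key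
    _ ≤ 2 * ((4 * κ) ^ 2 * ((1 + κ) * γ) + a / 4 * γ) * N := by
        refine mul_le_mul_of_nonneg_right (mul_le_mul_of_nonneg_left (add_le_add ?_ hT) (by norm_num)) hN0
        exact mul_le_mul hη2 hZ (integral_nonneg fun x => mul_nonneg (sq_nonneg _) (hw0 x)) (sq_nonneg _)
    _ ≤ 2 * ((4 * κ) ^ 2 * (2 * γ) + a / 4 * γ) * N := by
        refine mul_le_mul_of_nonneg_right (mul_le_mul_of_nonneg_left (add_le_add (mul_le_mul_of_nonneg_left ?_ (sq_nonneg _)) le_rfl) (by norm_num)) hN0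
        nlinarith
    _ = (2 * ((4 * κ) ^ 2 * 2) + a / 2) * γ * N := by ring
    _ ≤ (a / 2 + a / 2) * γ * N := by
        refine mul_le_mul_of_nonneg_right (mul_le_mul_of_nonneg_right ?_ hγ0) hN0
        linarith [hηβ]
    _ = a * γ * N := by ring

set_option maxHeartbeats 1600000 in
-- long record expressions.
/-- ★★★ **THE SAME IN THE LEAD'S NORMALISATION `Z̄ = ∫ Θ²w̄ dπ = fibreMass L (softWeight χ) Ω_c 1`**: `∃ M₀ ≥ 2, ∀ M ≥ M₀, ∀ a > 0, ∀ᶠ β, ∀ u, ∀ v` admissible with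
`fibreInner … v u = 0`:  `(∫_x v₁(oT u x)·Ω_c(x̂)·softWeight χ (oT 1 x) dπ)² ≤ a·Z̄(β)·∫_x v(oT u x)²·softWeight χ (oT u x) dπ` (`Z̄ ≥ (1−C_Pδ²)γ ≥ γ/2` by (B-N)
`…FibreMassBrick.fibreMass_brick_record` at `u = 1`). [cite: Luscher1983, §3] -/
theorem core_coeff_sq_le_mul_fibreMass_one_K {K : ℝ} (hK : 1 ≤ K) (hLz : Nonempty (NzSite L)) (hL : 2 ≤ L) {s : ℝ} (hs : 0 < s) (hs3 : s ≤ 1 / 3) :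
    ∃ M₀ : ℝ, 2 ≤ M₀ ∧ ∀ M : ℝ, M₀ ≤ M → ∀ a : ℝ, 0 < a → ∀ᶠ β : ℝ in atTop, ∀ u : GaugeConfig 3 1 SU2,
      ∀ v : GaugeConfig 3 L SU2 → ℝ, Measurable v → (∃ C : ℝ, ∀ U, |v U| ≤ C) → (∀ U, v U ≠ 0 → recordChi L s K M β U ≠ 0) →
        fibreInner L (softWeight (recordChi L s K M β)) (fun x : LinkSpace L => {x : LinkSpace L | linkCurry x ∈ capBalancedSet L}.indicator (fun _ => (1 : ℝ)) x *
          frozenProfile L (fun β' => stiffGaussExp L (β' / 2) β') (fun β' => min (1 / 40) (powScale (1 / 2) β' * btLog β')) β x) v u = 0 →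
        (∫ x, ({U : GaugeConfig 3 L SU2 | powScale 1 β * btLog β < ‖(gaugeModes L).starProjection (relLinkVec L U)‖} ∪
                  {U : GaugeConfig 3 L SU2 | min (1 / 40) (powScale (1 / 2) β * btLog β) / 2 < ‖relLinkVec L U‖})ᶜ.indicator v (orthoTube L u x) *
              ({x : LinkSpace L | linkCurry x ∈ capBalancedSet L}.indicator (fun _ => (1 : ℝ)) (linkEmbed L x) *
                frozenProfile L (fun β' => stiffGaussExp L (β' / 2) β') (fun β' => min (1 / 40) (powScale (1 / 2) β' * btLog β')) β (linkEmbed L x)) *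
              softWeight (recordChi L s K M β) (orthoTube L 1 x) ∂orthoTransverse L) ^ 2 ≤
          a * fibreMass L (softWeight (recordChi L s K M β)) (fun x : LinkSpace L => {x : LinkSpace L | linkCurry x ∈ capBalancedSet L}.indicator (fun _ => (1 : ℝ)) x *
              frozenProfile L (fun β' => stiffGaussExp L (β' / 2) β') (fun β' => min (1 / 40) (powScale (1 / 2) β' * btLog β')) β x) 1 *
            ∫ x, v (orthoTube L u x) ^ 2 * softWeight (recordChi L s K M β) (orthoTube L u x) ∂orthoTransverse L := by
  -- (P) once more, for the lower fibre-mass bound at `u = 1`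
  have hK0 : 0 < K := lt_of_lt_of_le one_pos hK
  have hδ0 : ∀ β, 0 < K * powScale s β := fun β => mul_pos hK0 (powScale_pos s β)
  have hδ : Tendsto (fun β => K * powScale s β) atTop (𝓝 0) := by simpa using (tendsto_powScale hs).const_mul K
  have hsd1 : ∀ᶠ β in atTop, 0 < powScale 1 β ∧ powScale 1 β ≤ (K * powScale s β) ^ 3 := by
    filter_upwards [eventually_ge_atTop (1 : ℝ)] with β hβ
    have hp := powScale_pos 1 β
    have h1 : powScale 1 β ≤ powScale s β ^ 3 := powScale_one_le_cube hs3 hβ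
    have hps0 : 0 ≤ powScale s β ^ 3 := pow_nonneg (powScale_pos s β).le 3
    refine ⟨hp, h1.trans ?_⟩
    calc powScale s β ^ 3 = 1 * powScale s β ^ 3 := (one_mul _).symm
      _ ≤ K ^ 3 * powScale s β ^ 3 := mul_le_mul_of_nonneg_right (one_le_pow₀ hK) hps0
      _ = (K * powScale s β) ^ 3 := by ring
  obtain ⟨M₁, hM₁, H₁⟩ := fpWeight_core_constant L hLz hδ0 hδ hsd1
  obtain ⟨M₂, hM₂, H₂⟩ := core_coeff_sq_le_mul_recordGamma_K (L := L) hK hLz hL hs hs3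
  refine ⟨max M₁ M₂, le_max_of_le_left hM₁, fun M hM a ha => ?_⟩
  have hM2 : 2 ≤ M := hM₁.trans ((le_max_left _ _).trans hM)
  obtain ⟨C, β₀, hC, hP⟩ := H₁ M ((le_max_left _ _).trans hM)
  have hδ2 : Tendsto (fun β => (K * powScale s β) ^ 2) atTop (𝓝 0) := by simpa using hδ.pow 2
  filter_upwards [eventually_ge_atTop β₀, eventually_mul_le_of_tendsto hδ2 C (by norm_num : (0 : ℝ) < 1 / 2),
    H₂ M ((le_max_right _ _).trans hM) (a / 2) (by positivity), eventually_orthoTube_one_mem_fatTube_K (L := L) hK hs (by linarith) hM2]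
    with β hβ0 hCδ hcore hgeo u v hv hCb hsupp horth
  have h := hcore u v hv hCb hsupp horth
  refine h.trans ?_
  -- `γ ≤ Z̄/(1−κ) ≤ 2Z̄`
  set κ : ℝ := C * (K * powScale s β) ^ 2 with hκdef
  have hκ0 : 0 ≤ κ := by positivity
  have hqfm : ∀ β', Measurable ((fun β'' : ℝ => stiffGaussExp L (β'' / 2) β'') β') := fun β' => measurable_stiffGaussExp _ _
  have hqf0 : ∀ β' x, 0 ≤ (fun β'' : ℝ => stiffGaussExp L (β'' / 2) β'') β' x := fun β' x => stiffGaussExp_nonneg _ _ x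
  have hΩGm : Measurable (frozenProfile L (fun β' => stiffGaussExp L (β' / 2) β') (fun β' => min (1 / 40) (powScale (1 / 2) β' * btLog β')) β) :=
    measurable_frozenProfile hqfm _ β
  have hΩG0 : ∀ x, 0 ≤ frozenProfile L (fun β' => stiffGaussExp L (β' / 2) β') (fun β' => min (1 / 40) (powScale (1 / 2) β' * btLog β')) β x :=
    fun x => (frozenProfile_mem_Icc hqf0 _ β x).1
  have hΩG1 : ∀ x, |frozenProfile L (fun β' => stiffGaussExp L (β' / 2) β') (fun β' => min (1 / 40) (powScale (1 / 2) β' * btLog β')) β x| ≤ 1 :=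
    abs_frozenProfile_le hqf0 _ β
  have hΩm := measurable_capRestrict (L := L) hΩGm
  have hΩ1 : ∀ x, |{x : LinkSpace L | linkCurry x ∈ capBalancedSet L}.indicator (fun _ => (1 : ℝ)) x *
      frozenProfile L (fun β' => stiffGaussExp L (β' / 2) β') (fun β' => min (1 / 40) (powScale (1 / 2) β' * btLog β')) β x| ≤ 1 :=
    fun x => (capRestrict_mem (L := L) hΩG0 hΩG1 x).2.2
  have hΩR : ∀ x, {x : LinkSpace L | linkCurry x ∈ capBalancedSet L}.indicator (fun _ => (1 : ℝ)) x *
      frozenProfile L (fun β' => stiffGaussExp L (β' / 2) β') (fun β' => min (1 / 40) (powScale (1 / 2) β' * btLog β')) β x ≠ 0 →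
      ‖x‖ ≤ min (1 / 40) (powScale (1 / 2) β * btLog β) := fun x hx => norm_le_of_frozenProfile_ne_zero _ _ β (right_ne_zero_of_mul hx)
  have hP' : ∀ U ∈ fatTubeRho L (fun β : ℝ => K * powScale s β) (fun b => M * (K * powScale s b)) β,
      fpWeightBar L (powScale 1 β) * (1 - κ) ≤ gaugeAvg (recordWeightRho L (fun β : ℝ => K * powScale s β) (fun b => M * (K * powScale s b)) (powScale 1) β) U ∧
      gaugeAvg (recordWeightRho L (fun β : ℝ => K * powScale s β) (fun b => M * (K * powScale s b)) (powScale 1) β) U ≤ fpWeightBar L (powScale 1 β) * (1 + κ) :=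
    fun U hU => hP β hβ0 U hU
  have hb := fibreMass_brick_record (L := L) (fun β : ℝ => K * powScale s β) (fun b => M * (K * powScale s b)) (powScale 1) β hP' hΩm hΩ1 hΩR
    (u := 1) (fun x _ hx => hgeo x hx)
  set γ := recordGamma L (fun β' => fun x : LinkSpace L => {x : LinkSpace L | linkCurry x ∈ capBalancedSet L}.indicator (fun _ => (1 : ℝ)) x *
      frozenProfile L (fun β'' => stiffGaussExp L (β'' / 2) β'') (fun β'' => min (1 / 40) (powScale (1 / 2) β'' * btLog β'')) β' x) β with hγdef
  set Z := fibreMass L (softWeight (recordChi L s K M β)) (fun x : LinkSpace L => {x : LinkSpace L | linkCurry x ∈ capBalancedSet L}.indicator (fun _ => (1 : ℝ)) x *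
      frozenProfile L (fun β' => stiffGaussExp L (β' / 2) β') (fun β' => min (1 / 40) (powScale (1 / 2) β' * btLog β')) β x) 1 with hZdef
  have hbZ : |Z - γ| ≤ κ * γ := hb
  have hγ0 : 0 ≤ γ := by
    rw [hγdef]; unfold recordGamma boGamma
    exact mul_nonneg (fpWeightBar_pos L (powScale_pos 1 β)).le (integral_nonneg fun v => mul_nonneg (sq_nonneg _) (Real.exp_pos _).le)
  have hγZ : γ ≤ 2 * Z := by
    have h1 := (abs_le.mp hbZ).1
    nlinarith
  have hN0 : 0 ≤ ∫ x, v (orthoTube L u x) ^ 2 * softWeight (recordChi L s K M β) (orthoTube L u x) ∂orthoTransverse L :=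
    integral_nonneg fun x => mul_nonneg (sq_nonneg _) ((softWeight_recordChi_props (L := L) s K M β).2.2.1 _)
  calc a / 2 * γ * ∫ x, v (orthoTube L u x) ^ 2 * softWeight (recordChi L s K M β) (orthoTube L u x) ∂orthoTransverse L
      ≤ a / 2 * (2 * Z) * ∫ x, v (orthoTube L u x) ^ 2 * softWeight (recordChi L s K M β) (orthoTube L u x) ∂orthoTransverse L :=
        mul_le_mul_of_nonneg_right (mul_le_mul_of_nonneg_left hγZ (by positivity)) hN0
    _ = a * Z * ∫ x, v (orthoTube L u x) ^ 2 * softWeight (recordChi L s K M β) (orthoTube L u x) ∂orthoTransverse L := by ring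

set_option maxHeartbeats 1600000 in
-- long record expressions.
/-- ★★★ **THE GROUND TERM OF THE CORE PIECE OF RECORD, INTEGRATED OVER THE SLOW VARIABLE** (see the module docstring). [cite: Luscher1983, §3] -/
theorem core_coeff_integral_le_K {K : ℝ} (hK : 1 ≤ K) (hLz : Nonempty (NzSite L)) (hL : 2 ≤ L) {s : ℝ} (hs : 0 < s) (hs3 : s ≤ 1 / 3) :
    ∃ M₀ : ℝ, 2 ≤ M₀ ∧ ∀ M : ℝ, M₀ ≤ M → ∀ a : ℝ, 0 < a → ∀ᶠ β : ℝ in atTop,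
      ∀ v : GaugeConfig 3 L SU2 → ℝ, Measurable v → (∃ C : ℝ, ∀ U, |v U| ≤ C) → (∀ U, v U ≠ 0 → recordChi L s K M β U ≠ 0) →
        (∀ u : GaugeConfig 3 1 SU2, fibreInner L (softWeight (recordChi L s K M β)) (fun x : LinkSpace L => {x : LinkSpace L | linkCurry x ∈ capBalancedSet L}.indicator (fun _ => (1 : ℝ)) x *
          frozenProfile L (fun β' => stiffGaussExp L (β' / 2) β') (fun β' => min (1 / 40) (powScale (1 / 2) β' * btLog β')) β x) v u = 0) →
        ∫ u, (∫ x, ({U : GaugeConfig 3 L SU2 | powScale 1 β * btLog β < ‖(gaugeModes L).starProjection (relLinkVec L U)‖} ∪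
                  {U : GaugeConfig 3 L SU2 | min (1 / 40) (powScale (1 / 2) β * btLog β) / 2 < ‖relLinkVec L U‖})ᶜ.indicator v (orthoTube L u x) *
              ({x : LinkSpace L | linkCurry x ∈ capBalancedSet L}.indicator (fun _ => (1 : ℝ)) (linkEmbed L x) *
                frozenProfile L (fun β' => stiffGaussExp L (β' / 2) β') (fun β' => min (1 / 40) (powScale (1 / 2) β' * btLog β')) β (linkEmbed L x)) *
              softWeight (recordChi L s K M β) (orthoTube L 1 x) ∂orthoTransverse L) ^ 2 /
            fibreMass L (softWeight (recordChi L s K M β)) (fun x : LinkSpace L => {x : LinkSpace L | linkCurry x ∈ capBalancedSet L}.indicator (fun _ => (1 : ℝ)) x *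
              frozenProfile L (fun β' => stiffGaussExp L (β' / 2) β') (fun β' => min (1 / 40) (powScale (1 / 2) β' * btLog β')) β x) 1 ∂configMeasure SU2 1 ≤
          a * tubeNormSq (softWeight (recordChi L s K M β)) v := by
  haveI := isFiniteMeasure_orthoTransverse L
  obtain ⟨M₀, hM₀, H⟩ := core_coeff_sq_le_mul_fibreMass_one_K (L := L) hK hLz hL hs hs3
  refine ⟨M₀, hM₀, fun M hM a ha => ?_⟩
  have hM0 : 0 ≤ M := le_trans (by norm_num) (hM₀.trans hM)
  filter_upwards [H M hM a ha, recordChi_support_K (L := L) hs hK hM0] with β hcore hsupp v hv hC hvs horth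
  obtain ⟨Cv, hCv⟩ := hC
  set χ := recordChi L s K M β with hχdef
  set Ω : LinkSpace L → ℝ := fun x => {x : LinkSpace L | linkCurry x ∈ capBalancedSet L}.indicator (fun _ => (1 : ℝ)) x *
    frozenProfile L (fun β' => stiffGaussExp L (β' / 2) β') (fun β' => min (1 / 40) (powScale (1 / 2) β' * btLog β')) β x with hΩdef
  set Z : ℝ := fibreMass L (softWeight χ) Ω 1 with hZdef
  set n2 : GaugeConfig 3 1 SU2 → ℝ := fun u => ∫ x, v (orthoTube L u x) ^ 2 * softWeight χ (orthoTube L u x) ∂orthoTransverse L with hn2def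
  obtain ⟨hwm, hwb, hw0, -⟩ := softWeight_recordChi_props (L := L) s K M β
  -- pointwise in `u`: `(…)²/Z̄ ≤ a·n_u²`
  have hpt : ∀ u : GaugeConfig 3 1 SU2,
      (∫ x, ({U : GaugeConfig 3 L SU2 | powScale 1 β * btLog β < ‖(gaugeModes L).starProjection (relLinkVec L U)‖} ∪
                {U : GaugeConfig 3 L SU2 | min (1 / 40) (powScale (1 / 2) β * btLog β) / 2 < ‖relLinkVec L U‖})ᶜ.indicator v (orthoTube L u x) *
            Ω (linkEmbed L x) * softWeight χ (orthoTube L 1 x) ∂orthoTransverse L) ^ 2 / Z ≤ a * n2 u := by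
    intro u
    have h := hcore u v hv ⟨Cv, hCv⟩ hvs (horth u)
    have hn0 : 0 ≤ n2 u := integral_nonneg fun x => mul_nonneg (sq_nonneg _) (hw0 _)
    by_cases hZ0 : Z ≤ 0
    · -- `Z ≥ 0` always; so `Z = 0` and the quotient vanishes
      have hZnn : 0 ≤ Z := by
        rw [hZdef]; unfold fibreMass; exact integral_nonneg fun x => mul_nonneg (sq_nonneg _) (hw0 _)
      have hZe : Z = 0 := le_antisymm hZ0 hZnn
      rw [hZe, div_zero]; exact mul_nonneg ha.le hn0
    · push Not at hZ0
      rw [div_le_iff₀ hZ0]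
      calc _ ≤ a * Z * n2 u := h
        _ = a * n2 u * Z := by ring
  -- integrate over `u`: the upper function is bounded measurable, the lower nonnegative
  have hGm : Measurable fun p : GaugeConfig 3 1 SU2 × (Edge 3 L → Fin 3 → ℝ) => v (orthoTube L p.1 p.2) ^ 2 * softWeight χ (orthoTube L p.1 p.2) :=
    ((hv.comp (measurable_orthoTube L)).pow_const 2).mul (hwm.comp (measurable_orthoTube L))
  have hGb : ∀ p : GaugeConfig 3 1 SU2 × (Edge 3 L → Fin 3 → ℝ), |v (orthoTube L p.1 p.2) ^ 2 * softWeight χ (orthoTube L p.1 p.2)| ≤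
      Cv ^ 2 * Real.exp ((Fintype.card (Edge 3 L) : ℝ) / powScale 1 β ^ 2) := fun p => by
    rw [abs_mul, abs_pow]; exact mul_le_mul (pow_le_pow_left₀ (abs_nonneg _) (hCv _) 2) (hwb _) (abs_nonneg _) (sq_nonneg _)
  obtain ⟨hn2m, hn2b⟩ := StiffDoor.measurable_integral_fibre (κ := orthoTransverse L)
    (F := fun p : GaugeConfig 3 1 SU2 × (Edge 3 L → Fin 3 → ℝ) => v (orthoTube L p.1 p.2) ^ 2 * softWeight χ (orthoTube L p.1 p.2)) hGm hGb
  have hn2i : Integrable n2 (configMeasure SU2 1) := integrable_of_measurable_abs_le _ hn2m fun u => hn2b u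
  have hstep : ∫ u, (∫ x, ({U : GaugeConfig 3 L SU2 | powScale 1 β * btLog β < ‖(gaugeModes L).starProjection (relLinkVec L U)‖} ∪
                {U : GaugeConfig 3 L SU2 | min (1 / 40) (powScale (1 / 2) β * btLog β) / 2 < ‖relLinkVec L U‖})ᶜ.indicator v (orthoTube L u x) *
            Ω (linkEmbed L x) * softWeight χ (orthoTube L 1 x) ∂orthoTransverse L) ^ 2 / Z ∂configMeasure SU2 1 ≤ ∫ u, a * n2 u ∂configMeasure SU2 1 := by
    refine integral_mono_of_nonneg (ae_of_all _ fun u => ?_) (hn2i.const_mul a) (ae_of_all _ hpt)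
    have hZnn : 0 ≤ Z := by
      rw [hZdef]; unfold fibreMass; exact integral_nonneg fun x => mul_nonneg (sq_nonneg _) (hw0 _)
    exact div_nonneg (sq_nonneg _) hZnn
  -- `∫_u n_u² = ‖v‖²_w` by the tube disintegration
  have hv0 : ∀ U, U ∉ orthoTubeSet L → v U = 0 := fun U hU => by
    by_contra h; exact hU (hsupp U (hvs U h)).2.2.1
  have hN : ∫ u, n2 u ∂configMeasure SU2 1 = tubeNormSq (softWeight χ) v := by
    rw [tubeNormSq_eq_tube_integral hwm hwb hv hCv hv0, integral_prod _ (integrable_of_measurable_abs_le _ hGm hGb)]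
  calc _ ≤ ∫ u, a * n2 u ∂configMeasure SU2 1 := hstep
    _ = a * tubeNormSq (softWeight χ) v := by rw [integral_const_mul, hN]

end Summit.QuantumFields.YangMills.Theorems.FemtoTransferGap.TwoLattice.ConstTube

end
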